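import Mathlib
import Literature.AlgebraicGeometry.Resolution.LocalBlowup
import Literature.AlgebraicGeometry.Resolution.TranscendenceDefect
import Literature.AlgebraicGeometry.Resolution.ResolutionOfSingularities
import Literature.AlgebraicGeometry.Resolution.ResolutionLU
import Literature.AlgebraicGeometry.Resolution.ArithmeticalThreefolds
import Literature.AlgebraicGeometry.Resolution.MonomializationAlongValuation
import Literature.AlgebraicGeometry.Resolution.RsopMonomialIdeals
import Literature.AlgebraicGeometry.Resolution.QuadraticTransformsRegular
import Literature.RingTheory.KrullDimension.AffineDimension
import Literature.RingTheory.KrullDimension.LocalizationDimension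
import Literature.AlgebraicGeometry.Resolution.AffineDomainEquidim
import Literature.AlgebraicGeometry.Resolution.ExcellentRingsFieldProofs
import Literature.AlgebraicGeometry.Resolution.ExcellentRingsEssFiniteType
import Literature.AlgebraicGeometry.Resolution.LocalBlowupModels
import Summits.ResolutionOfSingularities.ResolutionOfSingularities.Theorems.RadicialJungCleanModelsCleanLU3ArcPackage
import Summits.ResolutionOfSingularities.ResolutionOfSingularities.Theorems.RadicialJungCleanModelsCleanLU3Defectless
import Summits.ResolutionOfSingularities.ResolutionOfSingularities.Theorems.RadicialJungCleanModelsLens5TwistModel2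
import Summits.ResolutionOfSingularities.ResolutionOfSingularities.Theorems.RadicialJungCleanModelsLens5PRankTwoPort1
import Summits.ResolutionOfSingularities.ResolutionOfSingularities.Theorems.RadicialJungCleanModelsLens5PRankTwoPort2a
import HarnessLib

/-!
# PORT (T-slice module map §16 (vii), part 2b) of res-B-lens-5's `Lens5_PRankTwoAssembly.lean` rev 7: PORT 2 `port_monomialModel` — the M-side
# model of THEOREM T (twist field `k(S) = K^p(g₀)` for perfect `k`, its F-02 model via ✓ `TwistModel.exists_twist_model`, F-32 monomialisation of the
# graded coefficients, the `K`-side re-model `locAtCentre A₂ O`, `d = 3`, Laurent factorisation of every `f ∈ F`)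

Author res-B-lens-5 (g10); ported verbatim by res-B-lead-1 g5 (the kit references `TwistModel.*` now resolve to ✓ `…Lens5.TwistModel`).
OURS; nothing here proves resolution in characteristic `p`.
-/

noncomputable section

set_option linter.dupNamespace false -- mandated namespace of this single-conjunct summit

open IsLocalRing
open Literature.AlgebraicGeometry.Resolution
open Summit.ResolutionOfSingularities.ResolutionOfSingularities.Theorems.RadicialJung.CleanModels.Lens5.GradedBasis
open Summit.ResolutionOfSingularities.ResolutionOfSingularities.Theorems.RadicialJung.CleanModels.Lens5.ImmediateValues
open Summit.ResolutionOfSingularities.ResolutionOfSingularities.Theorems.RadicialJung.CleanModels.Lens5.PRankTwoCurrency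
open Summit.ResolutionOfSingularities.ResolutionOfSingularities.Theorems.RadicialJung.CleanModels.Lens5

namespace Summit.ResolutionOfSingularities.ResolutionOfSingularities.Theorems.RadicialJung.CleanModels.Lens5.PRankTwoAssembly

section PortTwo

open AlgebraicGeometry CategoryTheory

set_option linter.unusedVariables false in
set_option maxHeartbeats 800000 in
/-- **PORT 2 (§2 of the memo: the monomialising model of the twist field, `K`-side, `d = 3` pinned).  Size M.  PROVED (rev 5).**
Recipe: `S := t^p ∪ {g₁}` with `Algebra.adjoin k t = A` (`hAfg`) and `g₁ ∈ {g₀, g₀⁻¹} ∩ O` (✓ `TwistModel.mem_or_inv_mem_valuationSubring`);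
✓ `TwistModel.exists_twist_model` (F-02 = `hLU`; `dim A = 3` by ✓ `ringKrullDim_eq_three_of_locAtCentre`) gives the M-side regular model
`R = locAtCentre A'.toSubring (O ∩ k(S))` with every F-32 side condition; `k(S) = M` as subfields for perfect `k`
(✓ `adjoin_twist_toSubfield_eq_of_perfectField` + `subfield_closure_union_inv_eq` + the characterisation `hM`), so each `f ∈ F ⊆ M = Frac k[S]`
is `c_f / d_f`, `c_f, d_f ∈ k[S] ⊆ R`, non-zero; `xR := g · ∏_f c_f d_f` with any `0 ≠ g ∈ 𝔪_R` (`dim R = 3`); ✓ `monomialise_on_twist_model`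
(F-32 = `hEmb`, instances `letI := ((algebraMap ↥M K).comp R.subtype).toAlgebra`, `IsScalarTower.of_algebraMap_eq fun _ => rfl`) returns
`R'`, `uu`, `z : Fin d → R'` with `xR = u ∏ zᵢ^{αᵢ}`.  RE-MODEL: `A₂ :=` the image in `K` of `A' ⊔ k[uu]` (`Subalgebra.map`); by F-32's
domination and `τ/σ` clauses `range (algebraMap R' K) = locAtCentre A₂.toSubring O`, so regularity and `z` transport along the ring
isomorphism `R' ≃ locAtCentre A₂ O`; `dim (locAtCentre A₂ O) = 3` by the pattern of ✓ `locAtCentre_port_inputs` (centre maximal by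
✓ `centreIdeal_isMaximal_of_pow_generators` — `A₂[t] ⊇ A` is integral over `A₂` as `t^p ⊆ A₂` —, `dim A₂ = 3` by ✓ `ringKrullDim_eq_of_adjoin_le`),
hence `d = 3` (`ringKrullDim R' = d`).  Each factor `c_f`, `d_f` of `u ∏ zᵢ^{αᵢ}` is a unit times a monomial (tree ✓
`exists_eq_units_mul_prod_pow_of_dvd`, primes by `IsRsopPart.prime`), so `f = c_f/d_f` is a unit times a LAURENT monomial.
`∀ a ∈ A, a^p ∈ A₂`: ✓ `pow_mem_adjoin_image_pow`.  `locAtCentre A₂ O ⊆ M`: `A₂ ⊆ k(S) = M` and `M` is a field. -/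
theorem port_monomialModel (p : ℕ) [Fact p.Prime] {k : Type} [Field k] [CharP k p] [PerfectField k]
    {K : Type} [Field K] [Algebra k K] (hLU : LocalUniformization3 k)
    (hEmb : ∀ (Z : Scheme.{0}) [IsIntegral Z] [IsNoetherian Z], Scheme.IsRegular Z →
      Scheme.IsExcellent Z → ∀ (X : Set Z), IsClosed X → X ≠ Set.univ → topologicalKrullDim X ≤ 2 →
        ∃ (Z' : Scheme.{0}) (π : Z' ⟶ Z), IsProper π ∧ Function.Surjective π.base ∧
          (∃ U : Z.Opens, (U : Set Z) = Xᶜ ∧ IsIso (π ∣_ U)) ∧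
          IsStrictNormalCrossingsDivisor Z' (π.base ⁻¹' X))
    (O : ValuationSubring K) (A : Subalgebra k K)
    (hAO : A.toSubring ≤ O.toSubring) (hAfg : A.FG) [IsFractionRing A K] (hdimA : ringKrullDim A ≤ 3)
    (hdim3 : ringKrullDim (locAtCentre A.toSubring O) = 3)
    (hzd : ∀ (T : Subring K) (hT : T ≤ O.toSubring), A.toSubring ≤ T → (subringCentre T O hT).IsMaximal)
    (g₀ : K) (M : Subfield K) (hM : ∀ x : K, x ∈ M ↔ ∃ c : Fin p → K, ∑ j, c j ^ p * g₀ ^ (j : ℕ) = x)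
    (F : Finset K) (hFM : ∀ f ∈ F, f ∈ M) (hF0 : ∀ f ∈ F, f ≠ 0) :
    ∃ (A₂ : Subalgebra k K) (hA₂O : A₂.toSubring ≤ O.toSubring), A₂.FG ∧ (∀ a ∈ A, a ^ p ∈ A₂) ∧
      (∀ r : K, r ∈ locAtCentre A₂.toSubring O → r ∈ M) ∧
      ∃ (_ : IsRegularLocalRing (locAtCentre A₂.toSubring O)) (z : Fin 3 → locAtCentre A₂.toSubring O),
        Ideal.span (Set.range z) = IsLocalRing.maximalIdeal (locAtCentre A₂.toSubring O) ∧
        ringKrullDim (locAtCentre A₂.toSubring O) = 3 ∧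
        ∀ f ∈ F, ∃ (ε : K) (e : Fin 3 → ℤ), ε ∈ locAtCentre A₂.toSubring O ∧ O.valuation ε = 1 ∧
          f = ε * ∏ i, ((z i : K)) ^ (e i) := by
  /- (rev 5, res-B-lens-5 g10) PORT 2 PROVED — the docstring's recipe, with two remarks: (i) F-32 is invoked directly
     (✓ `exists_localRing_monomial_of_embeddedResolution`, `R ⊆ k(S) ⊆ K` with `IsScalarTower.of_algebraMap_eq fun _ => rfl`) on
     `xR = g · ∏_f c_f d_f`; every `c_f`, `d_f` then divides the monomial `u₂ ∏ z₂^α` in the re-modelled `R₂ = locAtCentre A₂ O`, so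
     ✓ `exists_eq_units_mul_prod_pow_of_dvd` factors it; (ii) the `d = 3` pinning (closed centre on `A₂ ⊇ t^p`, `dim A₂ = dim A = 3`,
     ✓ `ringKrullDim_locAtCentre_eq_of_isMaximal`) is the separate lemma ✓ `centre_closed_and_dim_three_of_pow_mem` — kept out of
     the main context on purpose (inlined, the kernel re-check of this block does not terminate in budget). -/
  classical
  haveI : CharP K p := charP_of_injective_algebraMap (algebraMap k K).injective p
  have hp : p.Prime := Fact.out
  have hAfg₀ := hAfg
  obtain ⟨t, ht⟩ := hAfg₀
  have hdimAeq : ringKrullDim A = 3 := ringKrullDim_eq_three_of_locAtCentre O A hAO hdimA hdim3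
  have hk : ∀ c : k, algebraMap k K c ∈ O := fun c => hAO (A.algebraMap_mem c)
  -- the `k`-subalgebra `O` (for `Algebra.adjoin_le` arguments)
  let Ok : Subalgebra k K := { O.toSubring with algebraMap_mem' := hk }
  have hOk : ∀ x : K, x ∈ Ok ↔ x ∈ O := fun _ => Iff.rfl
  obtain ⟨g₁, hg₁O, hg₁⟩ := TwistModel.mem_or_inv_mem_valuationSubring O g₀
  -- ## the twist field `k(S)`, `S = t^p ∪ {g₁}`, and its regular model (F-02 via ✓ `TwistModel.exists_twist_model`)
  set S : Set K := (fun x : K => x ^ p) '' (t : Set K) ∪ {g₁} with hSdef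
  obtain ⟨A', hA'O', hSA', hA'fg, hreg', hexc, hdim', hRO, hRm⟩ :=
    TwistModel.exists_twist_model p hLU O A hAO hAfg hdimAeq t ht hzd g₁ hg₁O S hSdef
  set R : Subring (IntermediateField.adjoin k S) :=
    locAtCentre A'.toSubring (O.comap (algebraMap (IntermediateField.adjoin k S) K)) with hRdef
  haveI : IsRegularLocalRing R := hreg'
  haveI : IsScalarTower R (IntermediateField.adjoin k S) K := IsScalarTower.of_algebraMap_eq (fun _ => rfl)
  have halgR : ∀ r : R, algebraMap R K r = ((r : IntermediateField.adjoin k S) : K) := fun _ => rfl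
  -- ## `k(S)` has underlying subfield `M = K^p(g₀)` (perfect `k`)
  have hM'sub : (IntermediateField.adjoin k S).toSubfield = Subfield.closure (Set.range (frobenius K p) ∪ {g₀}) := by
    rw [hSdef, TwistModel.adjoin_twist_toSubfield_eq_of_perfectField p A (t : Set K) ht g₁]
    rcases hg₁ with h | h
    · rw [h]
    · rw [h, TwistModel.subfield_closure_union_inv_eq]
  have hM'M : ∀ x : K, x ∈ IntermediateField.adjoin k S ↔ x ∈ M := by
    intro x
    rw [← IntermediateField.mem_toSubfield, hM'sub]
    constructor
    · intro hx
      refine (Subfield.closure_le (t := M)).mpr ?_ hx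
      rintro y (⟨c, rfl⟩ | hy)
      · refine (hM _).mpr ⟨fun j => if (j : ℕ) = 0 then c else 0, ?_⟩
        rw [Finset.sum_eq_single (⟨0, hp.pos⟩ : Fin p)]
        · simp [frobenius_def]
        · intro j _ hj
          have hj' : (j : ℕ) ≠ 0 := fun h => hj (Fin.ext h)
          simp [hj', hp.ne_zero]
        · intro h; exact absurd (Finset.mem_univ _) h
      · rw [Set.mem_singleton_iff.mp hy]
        refine (hM _).mpr ⟨fun j => if (j : ℕ) = 1 then 1 else 0, ?_⟩
        rw [Finset.sum_eq_single (⟨1, hp.one_lt⟩ : Fin p)]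
        · simp
        · intro j _ hj
          have hj' : (j : ℕ) ≠ 1 := fun h => hj (Fin.ext h)
          simp [hj', hp.ne_zero]
        · intro h; exact absurd (Finset.mem_univ _) h
    · intro hx
      obtain ⟨c, rfl⟩ := (hM x).mp hx
      have hg₀c : g₀ ∈ Subfield.closure (Set.range (frobenius K p) ∪ {g₀}) := Subfield.subset_closure (Or.inr rfl)
      refine sum_mem fun j _ => mul_mem ?_ (pow_mem hg₀c _)
      exact Subfield.subset_closure (Or.inl ⟨c j, frobenius_def _ _⟩)
  -- ## every `f ∈ F` is a quotient of two non-zero elements of `k[S]`, which lift to `R`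
  have hFfrac : ∀ f ∈ F, ∃ c d : K, c ∈ Algebra.adjoin k S ∧ d ∈ Algebra.adjoin k S ∧ c ≠ 0 ∧ d ≠ 0 ∧ f = c / d := by
    intro f hf
    have hfM' : f ∈ IntermediateField.adjoin k S := (hM'M f).mpr (hFM f hf)
    obtain ⟨c, hc, d, hd, hcd⟩ := IntermediateField.mem_adjoin_iff_div.mp hfM'
    have hd0 : d ≠ 0 := by
      rintro rfl
      rw [div_zero] at hcd
      exact hF0 f hf hcd
    have hc0 : c ≠ 0 := by
      rintro rfl
      rw [zero_div] at hcd
      exact hF0 f hf hcd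
    exact ⟨c, d, hc, hd, hc0, hd0, hcd⟩
  choose! cF dF hcF hdF hcF0 hdF0 hFeq using hFfrac
  have hpre : ∀ c : K, c ∈ Algebra.adjoin k S → ∃ r : R, algebraMap R K r = c := by
    intro c hc
    have hcM' : c ∈ IntermediateField.adjoin k S := IntermediateField.algebra_adjoin_le_adjoin k S hc
    have h1 : (⟨c, hcM'⟩ : IntermediateField.adjoin k S) ∈ A' :=
      hSA' ((TwistModel.mem_adjoin_preimage_iff S ⟨c, hcM'⟩).mpr hc)
    exact ⟨⟨⟨c, hcM'⟩, le_locAtCentre A'.toSubring _ h1⟩, rfl⟩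
  have hcpre : ∀ f ∈ F, ∃ r : R, algebraMap R K r = cF f := fun f hf => hpre _ (hcF f hf)
  have hdpre : ∀ f ∈ F, ∃ r : R, algebraMap R K r = dF f := fun f hf => hpre _ (hdF f hf)
  choose! rc hrc using hcpre
  choose! rd hrd using hdpre
  -- ## the element to monomialise: `xR = g · ∏_f c_f d_f`, `0 ≠ g ∈ 𝔪_R`
  have hmne : maximalIdeal R ≠ ⊥ := by
    intro h
    have hf : IsField R := (IsLocalRing.isField_iff_maximalIdeal_eq).mpr h
    have h0 := ringKrullDim_eq_zero_of_isField hf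
    rw [hdim'] at h0
    norm_num at h0
  obtain ⟨g, hgm, hg0⟩ := Submodule.exists_mem_ne_zero_of_ne_bot hmne
  set xR : R := g * ∏ f ∈ F, (rc f * rd f) with hxRdef
  have hxR0 : xR ≠ 0 := by
    refine mul_ne_zero hg0 (Finset.prod_ne_zero_iff.mpr fun f hf => mul_ne_zero ?_ ?_)
    · intro h
      exact hcF0 f hf (by rw [← hrc f hf, h, map_zero])
    · intro h
      exact hdF0 f hf (by rw [← hrd f hf, h, map_zero])
  have hxRm : xR ∈ maximalIdeal R := Ideal.mul_mem_right _ _ hgm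
  -- ## F-32 on the M-side model (✓ pattern of `TwistModel.monomialise_on_twist_model`)
  have hRO' : ∀ r : R, algebraMap R K r ∈ O := fun r => hRO r
  have hRm' : ∀ r : R, r ∈ maximalIdeal R ↔ O.valuation (algebraMap R K r) < 1 := fun r => hRm r
  obtain ⟨uu, huuM', huuO, R', _, _, _, hinj, hR'O, hR'm, hlow, hup, d, z, α, u, hu, hdimR', hspan, hfact⟩ :=
    exists_localRing_monomial_of_embeddedResolution hEmb (R := R) (K := IntermediateField.adjoin k S) (E := K)
      Subtype.val_injective hexc hdim' O
      hRO' hRm' xR hxR0 hxRm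
  -- ## RE-MODEL on the `K`-side: `T = R[uu]`, `B = A'` read in `K`, `A₂ = k[B ∪ uu]`, `locAtCentre T O = locAtCentre A₂ O`
  let T : Subring K := (Algebra.adjoin R (uu : Set K)).toSubring
  have hTO : T ≤ O.toSubring := fun w hw => huuO w hw
  have hTR : ∀ w ∈ T, w ∈ Set.range (algebraMap R' K) := fun w hw => hlow w hw
  have hRT : ∀ r : R, algebraMap R K r ∈ T := fun r => (Algebra.adjoin R (uu : Set K)).algebraMap_mem r
  have huuO' : ∀ w ∈ (uu : Set K), w ∈ O := fun w hw => huuO w (Algebra.subset_adjoin hw)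
  set φ : IntermediateField.adjoin k S →ₐ[k] K := IsScalarTower.toAlgHom k (IntermediateField.adjoin k S) K with hφdef
  have hφ : ∀ y : IntermediateField.adjoin k S, φ y = (y : K) := fun _ => rfl
  set B : Subalgebra k K := A'.map φ with hBdef
  have hBfg : B.FG := hA'fg.map φ
  have hBO : ∀ x ∈ (B : Set K), x ∈ O := by
    intro x hx
    obtain ⟨y, hy, rfl⟩ := Subalgebra.mem_map.mp hx
    exact ValuationSubring.mem_comap.mp (hA'O' hy)
  set A₂ : Subalgebra k K := Algebra.adjoin k ((B : Set K) ∪ ↑uu) with hA₂def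
  have hA₂fg : A₂.FG := fg_adjoin_subalgebra_union B hBfg uu
  have hBA₂ : B ≤ A₂ := fun x hx => Algebra.subset_adjoin (Or.inl hx)
  have huuA₂ : ∀ w ∈ (uu : Set K), w ∈ A₂ := fun w hw => Algebra.subset_adjoin (Or.inr hw)
  have hA₂Ok : A₂ ≤ Ok := Algebra.adjoin_le (Set.union_subset hBO huuO')
  have hA₂O : A₂.toSubring ≤ O.toSubring := fun x hx => hA₂Ok hx
  -- values in `O ∩ k(S)` are read in `K`
  have hval1 : ∀ y : IntermediateField.adjoin k S, y ∈ O.comap (algebraMap (IntermediateField.adjoin k S) K) →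
      ((O.comap (algebraMap (IntermediateField.adjoin k S) K)).valuation y = 1 ↔
        O.valuation (algebraMap (IntermediateField.adjoin k S) K y) = 1) := by
    intro y hy
    have hyO : algebraMap (IntermediateField.adjoin k S) K y ∈ O := ValuationSubring.mem_comap.mp hy
    have hlt := TwistModel.valuation_comap_lt_one_iff O (IntermediateField.adjoin k S) y hy
    have hle' : (O.comap (algebraMap (IntermediateField.adjoin k S) K)).valuation y ≤ 1 :=
      ((O.comap (algebraMap (IntermediateField.adjoin k S) K)).valuation_le_one_iff y).mpr hy
    have hle : O.valuation (algebraMap (IntermediateField.adjoin k S) K y) ≤ 1 := (O.valuation_le_one_iff _).mpr hyO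
    constructor
    · intro h1
      rcases hle.lt_or_eq with h | h
      · have h' := hlt.mpr h
        rw [h1] at h'
        exact absurd h' (lt_irrefl _)
      · exact h
    · intro h1
      rcases hle'.lt_or_eq with h | h
      · have h' := hlt.mp h
        rw [h1] at h'
        exact absurd h' (lt_irrefl _)
      · exact h
  have hrangeR : Set.range (algebraMap R K) = (locAtCentre B.toSubring O : Set K) := by
    ext x
    constructor
    · rintro ⟨r, rfl⟩
      obtain ⟨y, hy, w, hw, hw1, hr⟩ := (mem_locAtCentre_iff).mp r.2
      have hyB : (y : K) ∈ B := Subalgebra.mem_map.mpr ⟨y, hy, rfl⟩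
      have hwB : (w : K) ∈ B := Subalgebra.mem_map.mpr ⟨w, hw, rfl⟩
      have hw1' : O.valuation (w : K) = 1 := (hval1 w (hA'O' hw)).mp hw1
      refine (mem_locAtCentre_iff).mpr ⟨y, hyB, w, hwB, hw1', ?_⟩
      rw [halgR, hr]
      push_cast
      rfl
    · intro hx
      obtain ⟨y, hy, w, hw, hw1, rfl⟩ := (mem_locAtCentre_iff).mp hx
      obtain ⟨y', hy', rfl⟩ := Subalgebra.mem_map.mp hy
      obtain ⟨w', hw', rfl⟩ := Subalgebra.mem_map.mp hw
      have hw'1 : (O.comap (algebraMap (IntermediateField.adjoin k S) K)).valuation w' = 1 := (hval1 w' (hA'O' hw')).mpr hw1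
      refine ⟨⟨y' / w', (mem_locAtCentre_iff).mpr ⟨y', hy', w', hw', hw'1, rfl⟩⟩, ?_⟩
      rw [halgR]
      push_cast
      rfl
  have hT : T = Subring.closure ((locAtCentre B.toSubring O : Set K) ∪ ↑uu) := by
    change (Algebra.adjoin R (uu : Set K)).toSubring = _
    rw [Algebra.adjoin_eq_ring_closure, hrangeR]
  have hR₂eq : locAtCentre T O = locAtCentre A₂.toSubring O := by
    rw [hT, Summit.ResolutionOfSingularities.ResolutionOfSingularities.Theorems.PfaffLine.locAtCentre_closure_locAtCentre_union, Subalgebra.coe_toSubring, closure_subalgebra_union_eq]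
  -- regular data transported to `R₂ := locAtCentre A₂ O` along `R' ≅ range = R₂`
  set R₂ : Subring K := locAtCentre A₂.toSubring O with hR₂def
  have hrange0 : (algebraMap R' K).range = locAtCentre T O :=
    Summit.ResolutionOfSingularities.ResolutionOfSingularities.Theorems.RadicialJung.CleanModels.range_eq_locAtCentre
      (algebraMap R' K) O T hTR hR'm hup
  have hrange : (algebraMap R' K).range = R₂ := hrange0.trans hR₂eq
  obtain ⟨hreg₂, z₂, u₂, hz₂, hu₂K, hspan₂, hdim₂, hu₂⟩ :=
    Summit.ResolutionOfSingularities.ResolutionOfSingularities.Theorems.RadicialJung.CleanModels.regular_data_of_range_eq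
      (algebraMap R' K) hinj R₂ hrange z hspan hdimR' u hu
  haveI := hreg₂
  have hR₂O : R₂ ≤ O.toSubring := locAtCentre_le hA₂O
  have hTR₂ : T ≤ R₂ := le_of_le_of_eq (le_locAtCentre T O) hR₂eq
  -- ## `S ⊆ B`, hence `t^p ⊆ A₂` and `A^p ⊆ A₂`
  have hSB : ∀ s ∈ S, s ∈ B := by
    intro s hs
    have hsM' : s ∈ IntermediateField.adjoin k S := IntermediateField.subset_adjoin k S hs
    have h1 : (⟨s, hsM'⟩ : IntermediateField.adjoin k S) ∈ A' :=
      hSA' (Algebra.subset_adjoin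
        (show (⟨s, hsM'⟩ : IntermediateField.adjoin k S) ∈ (Subtype.val : IntermediateField.adjoin k S → K) ⁻¹' S from hs))
    exact Subalgebra.mem_map.mpr ⟨⟨s, hsM'⟩, h1, rfl⟩
  have hAp : ∀ a ∈ A, a ^ p ∈ A₂ := by
    intro a ha
    have ha' : a ∈ Algebra.adjoin k (t : Set K) := by rw [ht]; exact ha
    have h1 := TwistModel.pow_mem_adjoin_image_pow p (t : Set K) ha'
    refine (Algebra.adjoin_le ?_ : Algebra.adjoin k ((fun x : K => x ^ p) '' (t : Set K)) ≤ A₂) h1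
    intro s hs
    exact hBA₂ (hSB s (by rw [hSdef]; exact Or.inl hs))
  -- ## `d = 3`: ✓ `centre_closed_and_dim_three_of_pow_mem` (the centre of `O` on `A₂` is closed since `A₂[t] ⊇ A` is integral
  -- over `A₂`, and `dim A₂ = dim A = 3`), compared with `dim R₂ = d` from the regular data
  have htpA₂ : ∀ a ∈ (t : Set K), a ^ p ∈ A₂ := fun a ha => hAp a (by rw [← ht]; exact Algebra.subset_adjoin ha)
  obtain ⟨-, -, hdimR₂'⟩ :=
    centre_closed_and_dim_three_of_pow_mem hp.pos O A hAO hAfg hdimAeq t ht hzd A₂ hA₂O hA₂fg htpA₂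
  have hdimR₂ : ringKrullDim R₂ = 3 := hdimR₂'
  have hd3 : d = 3 := by
    have h := hdim₂.symm.trans hdimR₂
    exact_mod_cast h
  subst hd3
  -- ## `z₂` is a regular system of parameters; `xR = u₂ ∏ z₂^α` in `R₂`
  have hd' : (maximalIdeal R₂).spanFinrank = 3 := by
    have h := IsRegularLocalRing.spanFinrank_maximalIdeal (R := R₂)
    rw [hdim₂] at h
    exact_mod_cast h
  have hzr : IsRsopPart z₂ := isRsopPart_comp_of_rsop hd' z₂ hspan₂ id Function.injective_id
  have hz0 : ∀ i, (z₂ i : K) ≠ 0 := fun i h => hzr.ne_zero i (Subtype.ext h)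
  let ψ : R →+* R₂ := (algebraMap R K).codRestrict R₂ (fun r => hTR₂ (hRT r))
  have hψK : ∀ r : R, ((ψ r : R₂) : K) = algebraMap R K r := fun _ => rfl
  have hfact₂ : ψ xR = u₂ * ∏ i, z₂ i ^ α i := by
    apply Subtype.ext
    rw [hψK, hfact]
    push_cast
    simp only [hu₂K, hz₂]
  -- ## `locAtCentre A₂ O ⊆ M`
  let MR : Subalgebra R K :=
    { (IntermediateField.adjoin k S).toSubalgebra.toSubring with
      algebraMap_mem' := fun r : R => ((r : IntermediateField.adjoin k S)).2 }
  have huuMR : (uu : Set K) ⊆ (MR : Set K) := by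
    intro w hw
    obtain ⟨y, rfl⟩ := huuM' hw
    exact y.2
  have hTM' : ∀ x ∈ T, x ∈ IntermediateField.adjoin k S := fun x hx =>
    (Algebra.adjoin_le huuMR : Algebra.adjoin R (uu : Set K) ≤ MR) hx
  have hR₂M : ∀ r : K, r ∈ locAtCentre A₂.toSubring O → r ∈ M := by
    intro r hr
    have hr' : r ∈ locAtCentre T O := (le_of_eq hR₂eq.symm) hr
    obtain ⟨y, hy, w, hw, -, rfl⟩ := mem_locAtCentre_iff.mp hr'
    exact (hM'M _).mp (div_mem (hTM' y hy) (hTM' w hw))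
  -- ## assemble; per `f ∈ F`: `c_f`, `d_f` divide the monomial `u₂ ∏ z₂^α`, so `f = c_f / d_f` is a unit times a Laurent monomial
  refine ⟨A₂, hA₂O, hA₂fg, hAp, hR₂M, hreg₂, z₂, hspan₂, hdimR₂, ?_⟩
  intro f hf
  have hsplit_c : xR = rc f * (g * rd f * ∏ f' ∈ F.erase f, (rc f' * rd f')) := by
    rw [hxRdef, ← Finset.mul_prod_erase F (fun f' => rc f' * rd f') hf]
    ring
  have hsplit_d : xR = rd f * (g * rc f * ∏ f' ∈ F.erase f, (rc f' * rd f')) := by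
    rw [hxRdef, ← Finset.mul_prod_erase F (fun f' => rc f' * rd f') hf]
    ring
  have hdvd_c : ψ (rc f) ∣ ∏ i, z₂ i ^ α i :=
    (hu₂.dvd_mul_left).mp ⟨ψ (g * rd f * ∏ f' ∈ F.erase f, (rc f' * rd f')), by rw [← map_mul, ← hsplit_c, hfact₂]⟩
  have hdvd_d : ψ (rd f) ∣ ∏ i, z₂ i ^ α i :=
    (hu₂.dvd_mul_left).mp ⟨ψ (g * rc f * ∏ f' ∈ F.erase f, (rc f' * rd f')), by rw [← map_mul, ← hsplit_d, hfact₂]⟩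
  obtain ⟨c₁, β, hcβ⟩ := CossartPiltantMonomial.exists_eq_units_mul_prod_pow_of_dvd (fun i => hzr.prime i) α hdvd_c
  obtain ⟨c₂, γ, hdγ⟩ := CossartPiltantMonomial.exists_eq_units_mul_prod_pow_of_dvd (fun i => hzr.prime i) α hdvd_d
  have hcK : cF f = ((c₁ : R₂) : K) * ∏ i, (z₂ i : K) ^ β i := by
    have h := congrArg (fun w : R₂ => (w : K)) hcβ
    simp only [hψK, hrc f hf] at h
    rw [h]
    push_cast
    rfl
  have hdK : dF f = ((c₂ : R₂) : K) * ∏ i, (z₂ i : K) ^ γ i := by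
    have h := congrArg (fun w : R₂ => (w : K)) hdγ
    simp only [hψK, hrd f hf] at h
    rw [h]
    push_cast
    rfl
  let u' : R₂ := (c₁ * c₂⁻¹ : R₂ˣ)
  have hu' : IsUnit u' := Units.isUnit _
  let e : Fin 3 → ℤ := fun i => (β i : ℤ) - (γ i : ℤ)
  have hc₂0 : ((c₂ : R₂) : K) ≠ 0 := fun h => by
    have : ((c₂ : R₂) : K) * ((↑(c₂⁻¹ : R₂ˣ) : R₂) : K) = 1 := by
      rw [← Subring.coe_mul, ← Units.val_mul, mul_inv_cancel, Units.val_one, Subring.coe_one]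
    rw [h, zero_mul] at this
    exact zero_ne_one this
  have hu'K : (u' : K) = ((c₁ : R₂) : K) * (((c₂ : R₂) : K))⁻¹ := by
    have hinv : ((↑(c₂⁻¹ : R₂ˣ) : R₂) : K) = (((c₂ : R₂) : K))⁻¹ := by
      refine (eq_inv_of_mul_eq_one_right ?_)
      rw [← Subring.coe_mul, ← Units.val_mul, mul_inv_cancel, Units.val_one, Subring.coe_one]
    change (((c₁ * c₂⁻¹ : R₂ˣ) : R₂) : K) = _
    rw [Units.val_mul, Subring.coe_mul, hinv]
  have hprod : (∏ i, (z₂ i : K) ^ (e i)) = (∏ i, (z₂ i : K) ^ β i) / ∏ i, (z₂ i : K) ^ γ i := by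
    rw [← Finset.prod_div_distrib]
    refine Finset.prod_congr rfl fun i _ => ?_
    rw [zpow_sub₀ (hz0 i), zpow_natCast, zpow_natCast]
  refine ⟨(u' : K), e, u'.2, valuation_eq_one_of_isUnit_of_le O hR₂O hu', ?_⟩
  calc f = cF f / dF f := hFeq f hf
    _ = (u' : K) * ∏ i, (z₂ i : K) ^ (e i) := by
        rw [hcK, hdK, hu'K, hprod, mul_div_mul_comm, div_eq_mul_inv]


end PortTwo

end Summit.ResolutionOfSingularities.ResolutionOfSingularities.Theorems.RadicialJung.CleanModels.Lens5.PRankTwoAssembly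

end
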